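import Summits.Ventures.PercRepro0.ChiBox
import Summits.Ventures.PercRepro0.RightCont
import Summits.Ventures.PercRepro0.LowerBound

/-!
# R_MID-12 · NEWMAN TRANSFER — the finite-box cluster law (seat p2, part 1/3)

Lean twin of proofs/D7TRANSFER-p2-v1.md §2–§3 (cell pub-perc-repro0; lead RULING H (11)), in the
FINITE-BOX-ONLY shape (STATUS l.901 / l.903 (b)): everything happens inside the box `Λ_L`, where the
cluster of `0` is always finite.

* `boxCluster d L ω = {y | 0 ↔ y by an open path inside Λ_L}` (= `Defs.boxConn d L 0 y`), `boxK d L ω`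
  = the open bonds of `Λ_L` with both endpoints in the box cluster, `vert F` = the endpoints of `F`
  together with `0`, `boxExit d L F` = the bonds of `Λ_L` outside `F` touching `vert F`;
* the CLUSTER LAW (Lemma 1 of the paper): for `F = boxK d L η`,
  `boxK d L ω = F ↔ (F ⊆ ω ∧ Disjoint (boxExit d L F) ω)` (`boxK_eq_iff`), so `{boxK = F}` is the
  cylinder `L2.cylS` on `F ∪ boxExit F` (`setOf_boxKF_eq`) and `P_p(boxK = F) = p^{|F|} (1 − p)^{|∂F|}`
  (`P_boxKF_eq`), with the `Finset` versions `boxKF`, `boxExitF`, `vertF`, the set `animals d L` of the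
  bond sets of box clusters, and the weight `w d L F p = p^{|F|} (1 − p)^{|∂F|}`.

Continued in `NewmanTransferBox.lean` (the partition, the counting bound, the box identity) and
`NewmanTransfer.lean` (the transfer). Census evidence only (the D7 door's TRANSFER): nothing here bears
on the hypothesis `∫_0^{p_c} χ^{1/2} < ∞` for any `d`, nothing on `T(d)`, `3 ≤ d ≤ 10`.
-/

namespace Summit.Ventures.PercRepro0.Newman

open MeasureTheory ProbabilityTheory unitInterval Set Filter Topology
open Summit.Ventures.PercRepro0.Defs
open scoped ENNReal NNReal Classical

variable {d : ℕ}

/-! ### The box cluster of the origin and its open bonds -/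

/-- The box cluster of `0`: the vertices joined to `0` by an open path using bonds of `Λ_L` only. -/
def boxCluster (d L : ℕ) (ω : Config d) : Set (Vertex d) := {y | Conn d (ω ∩ boxBonds d L) 0 y}

/-- `y ∈ C_L(0)` is the event `boxConn d L 0 y` of `Defs`. -/
theorem mem_boxCluster_iff {L : ℕ} {ω : Config d} {y : Vertex d} :
    y ∈ boxCluster d L ω ↔ ω ∈ boxConn d L 0 y := Iff.rfl

/-- The open bonds of the box cluster: open genuine bonds of `Λ_L` with both endpoints in `C_L(0)`. -/
def boxK (d L : ℕ) (ω : Config d) : Set (Sym2 (Vertex d)) :=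
  {e | e ∈ bonds d ∧ e ∈ boxBonds d L ∧ e ∈ ω ∧ ∀ v ∈ e, v ∈ boxCluster d L ω}

/-- The vertex set of a bond set, with the origin adjoined (`vert ∅ = {0}`). -/
def vert (F : Set (Sym2 (Vertex d))) : Set (Vertex d) := {v | v = 0 ∨ ∃ e ∈ F, v ∈ e}

/-- The exit set of `F` inside `Λ_L`: genuine bonds of `Λ_L` not in `F` touching `vert F`. -/
def boxExit (d L : ℕ) (F : Set (Sym2 (Vertex d))) : Set (Sym2 (Vertex d)) :=
  {e | e ∈ bonds d ∧ e ∈ boxBonds d L ∧ e ∉ F ∧ ∃ v ∈ e, v ∈ vert F}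

/-- A bond of the lattice between `x` and `y` is the bond `s(x, y)` with `x ~ y`. -/
theorem adj_of_mem_bonds {x y : Vertex d} (h : s(x, y) ∈ bonds d) : (lattice d).Adj x y :=
  (SimpleGraph.mem_edgeSet (lattice d)).1 h

/-- Connection inside the box is the reflexive–transitive closure of the open-box-bond relation. -/
theorem boxConn_iff_reflTransGen {L : ℕ} (ω : Config d) (x y : Vertex d) :
    Conn d (ω ∩ boxBonds d L) x y ↔ Relation.ReflTransGen (L2.OAdj (ω ∩ boxBonds d L)) x y :=
  L2.conn_iff_reflTransGen _ x y

/-- One open box bond from a vertex of the box cluster stays in the box cluster. -/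
theorem mem_boxCluster_of_oAdj {L : ℕ} {ω : Config d} {x y : Vertex d}
    (hx : x ∈ boxCluster d L ω) (hxy : L2.OAdj (ω ∩ boxBonds d L) x y) : y ∈ boxCluster d L ω := by
  unfold boxCluster at hx ⊢
  rw [Set.mem_setOf_eq, boxConn_iff_reflTransGen] at hx ⊢
  exact hx.tail hxy

/-- `0` lies in its box cluster. -/
theorem zero_mem_boxCluster (L : ℕ) (ω : Config d) : (0 : Vertex d) ∈ boxCluster d L ω :=
  SimpleGraph.Reachable.refl _

/-- The open bonds of the box cluster are exactly the open box bonds between two of its vertices. -/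
theorem mem_boxK_iff {L : ℕ} {ω : Config d} {x y : Vertex d} :
    s(x, y) ∈ boxK d L ω ↔
      (lattice d).Adj x y ∧ s(x, y) ∈ boxBonds d L ∧ s(x, y) ∈ ω ∧
        x ∈ boxCluster d L ω ∧ y ∈ boxCluster d L ω := by
  simp only [boxK, Set.mem_setOf_eq, SimpleGraph.mem_edgeSet, bonds]
  constructor
  · rintro ⟨hadj, hbox, hω, hv⟩
    exact ⟨hadj, hbox, hω, hv x (Sym2.mem_mk_left x y), hv y (Sym2.mem_mk_right x y)⟩
  · rintro ⟨hadj, hbox, hω, hx, hy⟩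
    refine ⟨hadj, hbox, hω, fun v hv => ?_⟩
    rcases Sym2.mem_iff.1 hv with rfl | rfl
    · exact hx
    · exact hy

/-- Lemma 1 (⇒), vertex form: the vertex set of `boxK` is the box cluster. -/
theorem vert_boxK (L : ℕ) (ω : Config d) : vert (boxK d L ω) = boxCluster d L ω := by
  ext y
  constructor
  · rintro (rfl | ⟨e, he, hy⟩)
    · exact zero_mem_boxCluster L ω
    · exact he.2.2.2 y hy
  · intro hy
    have hy' := hy
    unfold boxCluster at hy'
    rw [Set.mem_setOf_eq, boxConn_iff_reflTransGen] at hy'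
    induction hy' with
    | refl => exact Or.inl rfl
    | @tail x z hx hxz _ =>
      refine Or.inr ⟨s(x, z), ?_, Sym2.mem_mk_right x z⟩
      have hxc : x ∈ boxCluster d L ω := by
        unfold boxCluster; rw [Set.mem_setOf_eq, boxConn_iff_reflTransGen]; exact hx
      exact mem_boxK_iff.2 ⟨hxz.1, hxz.2.2, hxz.2.1, hxc, hy⟩

/-- The open bonds of the box cluster are open. -/
theorem boxK_subset (L : ℕ) (ω : Config d) : boxK d L ω ⊆ ω := fun _ he => he.2.2.1

/-- The open bonds of the box cluster are genuine bonds. -/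
theorem boxK_subset_bonds (L : ℕ) (ω : Config d) : boxK d L ω ⊆ bonds d := fun _ he => he.1

/-- The open bonds of the box cluster lie in the box. -/
theorem boxK_subset_boxBonds (L : ℕ) (ω : Config d) : boxK d L ω ⊆ boxBonds d L := fun _ he => he.2.1

/-- The exit set consists of genuine bonds of the box. -/
theorem boxExit_subset_boxBonds (L : ℕ) (F : Set (Sym2 (Vertex d))) :
    boxExit d L F ⊆ boxBonds d L := fun _ he => he.2.1

/-- The exit set consists of genuine bonds. -/
theorem boxExit_subset_bonds (L : ℕ) (F : Set (Sym2 (Vertex d))) :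
    boxExit d L F ⊆ bonds d := fun _ he => he.1

/-- The exit set is disjoint from `F`. -/
theorem disjoint_boxExit (L : ℕ) (F : Set (Sym2 (Vertex d))) : Disjoint F (boxExit d L F) :=
  Set.disjoint_left.2 fun _ hF he => he.2.2.1 hF

/-- Lemma 1 (⇒): every exit bond of the box cluster's bond set is closed. -/
theorem boxExit_boxK_disjoint (L : ℕ) (ω : Config d) : Disjoint (boxExit d L (boxK d L ω)) ω := by
  refine Set.disjoint_left.2 fun e he heω => ?_
  obtain ⟨hb, hbox, hnot, v, hv, hvF⟩ := he
  rw [vert_boxK] at hvF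
  obtain ⟨v', rfl⟩ : ∃ v', s(v, v') = e := ⟨Sym2.Mem.other hv, Sym2.other_spec hv⟩
  have hadj : (lattice d).Adj v v' := adj_of_mem_bonds hb
  have hv'c : v' ∈ boxCluster d L ω :=
    mem_boxCluster_of_oAdj hvF ⟨hadj, Set.mem_inter heω hbox⟩
  exact hnot (mem_boxK_iff.2 ⟨hadj, hbox, heω, hvF, hv'c⟩)

/-- Lemma 1 (⇐), first half: if the bonds of `boxK η` are open in `ω` and its exits closed, then
the box cluster of `ω` is the box cluster of `η`. -/
theorem boxCluster_eq_of (L : ℕ) (η ω : Config d) (hsub : boxK d L η ⊆ ω)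
    (hdisj : Disjoint (boxExit d L (boxK d L η)) ω) : boxCluster d L ω = boxCluster d L η := by
  ext y
  constructor
  · intro hy
    unfold boxCluster at hy ⊢
    rw [Set.mem_setOf_eq, boxConn_iff_reflTransGen] at hy ⊢
    induction hy with
    | refl => exact Relation.ReflTransGen.refl
    | @tail x z _ hxz ih =>
      refine ih.tail ?_
      have hxη : x ∈ boxCluster d L η := by
        unfold boxCluster; rw [Set.mem_setOf_eq, boxConn_iff_reflTransGen]; exact ih
      by_cases hF : s(x, z) ∈ boxK d L η
      · exact ⟨hxz.1, Set.mem_inter hF.2.2.1 hxz.2.2⟩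
      · exfalso
        have hexit : s(x, z) ∈ boxExit d L (boxK d L η) :=
          ⟨(SimpleGraph.mem_edgeSet (lattice d)).2 hxz.1, hxz.2.2, hF,
            x, Sym2.mem_mk_left x z, by rw [vert_boxK]; exact hxη⟩
        exact Set.disjoint_left.1 hdisj hexit hxz.2.1
  · intro hy
    unfold boxCluster at hy ⊢
    rw [Set.mem_setOf_eq, boxConn_iff_reflTransGen] at hy ⊢
    induction hy with
    | refl => exact Relation.ReflTransGen.refl
    | @tail x z hx hxz ih =>
      refine ih.tail ?_
      have hxc : x ∈ boxCluster d L η := by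
        unfold boxCluster; rw [Set.mem_setOf_eq, boxConn_iff_reflTransGen]; exact hx
      have hzc : z ∈ boxCluster d L η := mem_boxCluster_of_oAdj hxc hxz
      have hF : s(x, z) ∈ boxK d L η := mem_boxK_iff.2 ⟨hxz.1, hxz.2.2, hxz.2.1, hxc, hzc⟩
      exact ⟨hxz.1, Set.mem_inter (hsub hF) hxz.2.2⟩

/-- Lemma 1 (⇐): the bond set of the box cluster of `ω` is `boxK η`. -/
theorem boxK_eq_of (L : ℕ) (η ω : Config d) (hsub : boxK d L η ⊆ ω)
    (hdisj : Disjoint (boxExit d L (boxK d L η)) ω) : boxK d L ω = boxK d L η := by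
  have hC := boxCluster_eq_of L η ω hsub hdisj
  ext e
  induction e using Sym2.ind with
  | _ x z =>
    rw [mem_boxK_iff, mem_boxK_iff, hC]
    constructor
    · rintro ⟨hadj, hbox, hω, hx, hz⟩
      by_cases hF : s(x, z) ∈ boxK d L η
      · exact mem_boxK_iff.1 hF
      · exfalso
        have hexit : s(x, z) ∈ boxExit d L (boxK d L η) :=
          ⟨(SimpleGraph.mem_edgeSet (lattice d)).2 hadj, hbox, hF, x, Sym2.mem_mk_left x z,
            by rw [vert_boxK]; exact hx⟩
        exact Set.disjoint_left.1 hdisj hexit hω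
    · rintro ⟨hadj, hbox, hη, hx, hz⟩
      exact ⟨hadj, hbox, hsub (mem_boxK_iff.2 ⟨hadj, hbox, hη, hx, hz⟩), hx, hz⟩

/-- LEMMA 1 (the cluster law): for `F = boxK d L η`, `boxK d L ω = F` iff `F` is open in `ω` and its
exit set is closed in `ω`. -/
theorem boxK_eq_iff (L : ℕ) (η ω : Config d) :
    boxK d L ω = boxK d L η ↔ boxK d L η ⊆ ω ∧ Disjoint (boxExit d L (boxK d L η)) ω := by
  constructor
  · intro h
    rw [← h]
    exact ⟨boxK_subset L ω, boxExit_boxK_disjoint L ω⟩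
  · rintro ⟨hsub, hdisj⟩
    exact boxK_eq_of L η ω hsub hdisj

/-! ### Finite versions: the bonds of the box, the animals, the weights -/

/-- The bonds of `Λ_L` as a `Finset`. -/
noncomputable def boxBondsF (d L : ℕ) : Finset (Sym2 (Vertex d)) := (boxBonds_finite L).toFinset

/-- `boxBondsF` is the `Finset` of the bonds of `Λ_L`. -/
theorem mem_boxBondsF {L : ℕ} {e : Sym2 (Vertex d)} : e ∈ boxBondsF d L ↔ e ∈ boxBonds d L :=
  Set.Finite.mem_toFinset _

/-- The bond set of the box cluster as a `Finset`. -/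
noncomputable def boxKF (d L : ℕ) (ω : Config d) : Finset (Sym2 (Vertex d)) :=
  (boxBondsF d L).filter (fun e => e ∈ boxK d L ω)

/-- The coercion of `boxKF` is `boxK`. -/
theorem coe_boxKF (L : ℕ) (ω : Config d) : (↑(boxKF d L ω) : Set (Sym2 (Vertex d))) = boxK d L ω := by
  ext e
  simp only [boxKF, Finset.coe_filter, mem_boxBondsF, Set.mem_setOf_eq]
  exact ⟨fun h => h.2, fun h => ⟨boxK_subset_boxBonds L ω h, h⟩⟩

/-- Membership in `boxKF`. -/
theorem mem_boxKF {L : ℕ} {ω : Config d} {e : Sym2 (Vertex d)} : e ∈ boxKF d L ω ↔ e ∈ boxK d L ω := by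
  rw [← Finset.mem_coe, coe_boxKF]

/-- The exit set of a finite bond set, as a `Finset`. -/
noncomputable def boxExitF (d L : ℕ) (F : Finset (Sym2 (Vertex d))) : Finset (Sym2 (Vertex d)) :=
  (boxBondsF d L).filter (fun e => e ∈ boxExit d L (↑F : Set (Sym2 (Vertex d))))

/-- Membership in `boxExitF`. -/
theorem mem_boxExitF {L : ℕ} {F : Finset (Sym2 (Vertex d))} {e : Sym2 (Vertex d)} :
    e ∈ boxExitF d L F ↔ e ∈ boxExit d L (↑F : Set (Sym2 (Vertex d))) := by
  simp only [boxExitF, Finset.mem_filter, mem_boxBondsF]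
  exact ⟨fun h => h.2, fun h => ⟨boxExit_subset_boxBonds L _ h, h⟩⟩

/-- The vertex set of a finite bond set, as a `Finset` (its elements lie in `Λ_L`). -/
noncomputable def vertF (d L : ℕ) (F : Finset (Sym2 (Vertex d))) : Finset (Vertex d) :=
  (Sharp.boxF d L).filter (fun v => v ∈ vert (↑F : Set (Sym2 (Vertex d))))

/-- The animals of `Λ_L`: the bond sets of box clusters. -/
noncomputable def animals (d L : ℕ) : Finset (Finset (Sym2 (Vertex d))) :=
  (boxBondsF d L).powerset.filter (fun F => ∃ ω : Config d, boxKF d L ω = F)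

/-- The bond set of every box cluster is an animal. -/
theorem boxKF_mem_animals (L : ℕ) (ω : Config d) : boxKF d L ω ∈ animals d L := by
  refine Finset.mem_filter.2 ⟨Finset.mem_powerset.2 (Finset.filter_subset _ _), ω, rfl⟩

/-- Every animal is the bond set of some box cluster. -/
theorem exists_of_mem_animals {L : ℕ} {F : Finset (Sym2 (Vertex d))} (hF : F ∈ animals d L) :
    ∃ ω : Config d, boxKF d L ω = F := (Finset.mem_filter.1 hF).2

/-- The weight `w_F(p) = p^{|F|} (1 − p)^{|∂F|}` of an animal. -/
noncomputable def w (d L : ℕ) (F : Finset (Sym2 (Vertex d))) (p : ℝ) : ℝ :=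
  p ^ F.card * (1 - p) ^ (boxExitF d L F).card

/-- Weights are non-negative on `[0, 1]`. -/
theorem w_nonneg (L : ℕ) (F : Finset (Sym2 (Vertex d))) {p : ℝ} (h0 : 0 ≤ p) (h1 : p ≤ 1) :
    0 ≤ w d L F p :=
  mul_nonneg (pow_nonneg h0 _) (pow_nonneg (by linarith) _)

/-! ### The law of `{boxK = F}` -/

/-- The event `{boxK ω = F}` for an animal `F` is the cylinder «`F` open, `∂F` closed». -/
theorem setOf_boxKF_eq (L : ℕ) (η : Config d) :
    {ω : Config d | boxKF d L ω = boxKF d L η} =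
      L2.cylS (boxKF d L η ∪ boxExitF d L (boxKF d L η))
        (fun e => decide ((e : Sym2 (Vertex d)) ∈ boxKF d L η)) := by
  ext ω
  simp only [Set.mem_setOf_eq, L2.mem_cylS, decide_eq_true_eq]
  have hiff : boxKF d L ω = boxKF d L η ↔ boxK d L ω = boxK d L η := by
    rw [← coe_boxKF, ← coe_boxKF]
    exact Finset.coe_inj.symm
  rw [hiff, boxK_eq_iff]
  constructor
  · rintro ⟨hsub, hdisj⟩ ⟨e, he⟩
    simp only
    rcases Finset.mem_union.1 he with hF | hE
    · have hF' : e ∈ boxK d L η := mem_boxKF.1 hF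
      exact ⟨fun _ => hF, fun _ => hsub hF'⟩
    · have hE' : e ∈ boxExit d L (boxK d L η) := by
        have := mem_boxExitF.1 hE
        rwa [coe_boxKF] at this
      refine ⟨fun hω => absurd hω (Set.disjoint_left.1 hdisj hE'), fun hF => ?_⟩
      exact absurd (mem_boxKF.1 hF) hE'.2.2.1
  · intro h
    refine ⟨fun e he => ?_, Set.disjoint_left.2 fun e he heω => ?_⟩
    · have he' : e ∈ boxKF d L η := mem_boxKF.2 he
      exact (h ⟨e, Finset.mem_union_left _ he'⟩).2 he'
    · have he' : e ∈ boxExitF d L (boxKF d L η) := by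
        rw [mem_boxExitF, coe_boxKF]; exact he
      have := (h ⟨e, Finset.mem_union_right _ he'⟩).1 heω
      exact he.2.2.1 (mem_boxKF.1 this)

/-- `{boxKF = F}` is measurable (a cylinder event). -/
theorem measurableSet_boxKF_eq (L : ℕ) (η : Config d) :
    MeasurableSet {ω : Config d | boxKF d L ω = boxKF d L η} := by
  rw [setOf_boxKF_eq]
  exact L2.measurableSet_cylS _ _

/-- The bonds of an animal and of its exit set are genuine bonds. -/
theorem mem_bonds_of_mem_union {L : ℕ} (η : Config d) {e : Sym2 (Vertex d)}
    (he : e ∈ boxKF d L η ∪ boxExitF d L (boxKF d L η)) : e ∈ bonds d := by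
  rcases Finset.mem_union.1 he with h | h
  · exact boxK_subset_bonds L η (mem_boxKF.1 h)
  · exact boxExit_subset_bonds L _ (mem_boxExitF.1 h)

/-- The law of `{boxK = F}`: `P_p(boxKF ω = F) = w_F(p)` for an animal `F` (Lemma 1, weight form). -/
theorem P_boxKF_eq (L : ℕ) (η : Config d) (p : I) :
    (P d p {ω : Config d | boxKF d L ω = boxKF d L η}).toReal = w d L (boxKF d L η) p := by
  rw [setOf_boxKF_eq, L2.measureReal_cylS _ (fun e he => mem_bonds_of_mem_union η he)]
  set F := boxKF d L η with hF
  set E := F ∪ boxExitF d L F with hE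
  have hdisj : Disjoint F (boxExitF d L F) := by
    rw [Finset.disjoint_left]
    intro e heF heE
    exact (mem_boxExitF.1 heE).2.2.1 (Finset.mem_coe.2 heF)
  rw [Finset.prod_coe_sort E (fun e => if decide (e ∈ F) = true then (p : ℝ) else 1 - p)]
  simp only [decide_eq_true_eq]
  rw [Finset.prod_ite]
  have h1 : E.filter (fun e => e ∈ F) = F := by
    ext e
    simp only [Finset.mem_filter, hE, Finset.mem_union]
    exact ⟨fun h => h.2, fun h => ⟨Or.inl h, h⟩⟩
  have h2 : E.filter (fun e => ¬ e ∈ F) = boxExitF d L F := by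
    ext e
    simp only [Finset.mem_filter, hE, Finset.mem_union]
    constructor
    · rintro ⟨h | h, hn⟩
      · exact absurd h hn
      · exact h
    · intro h
      exact ⟨Or.inr h, fun hF' => Finset.disjoint_left.1 hdisj hF' h⟩
  rw [h1, h2, Finset.prod_const, Finset.prod_const]
  rfl

end Summit.Ventures.PercRepro0.Newman
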